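import Summits.Ventures.HSemireg.BifunctorMappingCone
import Summits.Ventures.HSemireg.DerivedDescent
import Mathlib.Algebra.Homology.DerivedCategory.ShortExact
import HarnessLib

/-!
# The descended functor of `Φ = mapBifunctor (–) K₂ F` is compatible with connecting morphisms

Pure homological algebra (Mathlib level), sequel to `BifunctorMappingCone.lean`.  Let `F : C ⥤ C₂ ⥤ C` be a
bifunctor (additive in both variables) on an abelian category `C` with a derived category, `K₂` a fixed cochain
complex in `C₂`, and `Φ := F.map₂CochainComplex.flip.obj K₂ : CochainComplex C ℤ ⥤ CochainComplex C ℤ` (the total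
complex in the first variable).  If `Φ ⋙ Q` inverts quasi-isomorphisms, `Φ` descends to
`derivedLift Φ : D(C) ⥤ D(C)` (`DerivedDescent.lean`, p3).  We prove the analogue of Mathlib's
`DerivedCategory.map_triangleOfSESδ` (stated there for prolonged exact functors `G.mapDerivedCategory`):

* `derivedLift_map_triangleOfSESδ` — for a short exact `S` with `Φ S` short exact,
  `(derivedLift Φ).map (δ_S) = Fac ≫ δ_{Φ S} ≫ Fac⁻¹⟦1⟧ ≫ (commShiftIso 1)⁻¹`;
* `shiftedHomMap_triangleOfSESδ` — in the `ShiftedHom` packaging of `DerivedDescent.shiftedHomMap`: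
  **`Φ_*(δ_S) = δ_{Φ S}`**.

HONEST FRAMING (cell pub-hsemireg, seat gs-g4): with `F` the internal-Hom bifunctor of `𝓞_X`-modules and `K₂` the
dual complex of a strictly perfect `K•`, `Φ = 𝓗om•(K•, –)` (`HomComplex.homFunctor`) and `Φ_*` is the map through
which the tree DEFINES the semiregularity components `σ_q` of a complex (`HomComplexSigma.lean`); this file is what
lets `σ_q` of a genuine complex be computed against connecting morphisms (Atiyah steps of other complexes, cocycle
extensions).  Generic plumbing; NOT a door, NOT a named fact; nothing here says HC, HC_CM or HC_AV is proved.

## References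
* Mathlib: `Algebra.Homology.DerivedCategory.Ext.Map` (`DerivedCategory.map_triangleOfSESδ`, whose proof is
  transcribed here), `DerivedCategory.ShortExact`, `CategoryTheory.Shift.Localization`
  (`NatTrans.commShift_iso_hom_of_localization`). Folklore.
-/

noncomputable section

set_option backward.isDefEq.respectTransparency false

open CategoryTheory CategoryTheory.Category CategoryTheory.Limits DerivedCategory

namespace Summit.Ventures.HSemireg

namespace BifunctorCone

open CochainComplex CochainComplex.mappingCone

universe w

variable {C C₂ : Type*} [Category C] [Category C₂] [Abelian C] [Preadditive C₂]
  (F : C ⥤ C₂ ⥤ C) [F.Additive] [∀ X₁ : C, (F.obj X₁).Additive]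
  [∀ (K₁ : CochainComplex C ℤ) (K₂ : CochainComplex C₂ ℤ), CochainComplex.HasMapBifunctor K₁ K₂ F]
  (K₂ : CochainComplex C₂ ℤ)

/-- `Φ(descShortComplex S) = iso ≫ descShortComplex (Φ S)` in the functor spelling. [folklore] -/
theorem map_descShortComplex (S : ShortComplex (CochainComplex C ℤ)) :
    (F.map₂CochainComplex.flip.obj K₂).map (descShortComplex S) =
      (mapBifunctorMappingConeIso F S.f K₂).hom ≫ descShortComplex (S.map (F.map₂CochainComplex.flip.obj K₂)) := by
  have h0 : φ' F S.f K₂ ≫ HomologicalComplex.mapBifunctorMap S.g (𝟙 K₂) F (.up ℤ) = 0 := by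
    change (F.map₂CochainComplex.flip.obj K₂).map S.f ≫ (F.map₂CochainComplex.flip.obj K₂).map S.g = 0
    rw [← Functor.map_comp, S.zero, Functor.map_zero]
  exact (hom_comp_desc_zero F S.f K₂ S.g S.zero (by rw [HomComplex.δ_zero, h0, HomComplex.Cochain.ofHom_zero])).symm

/-- `Φ(δ_φ) ≫ (Φ.commShiftIso 1) = iso ≫ δ_{Φ φ}` in the functor spelling (`map_triangle_mor₃`). [folklore] -/
theorem map_triangle_mor₃' {K₁ L₁ : CochainComplex C ℤ} (φ : K₁ ⟶ L₁) :
    (F.map₂CochainComplex.flip.obj K₂).map (triangle φ).mor₃ ≫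
        ((F.map₂CochainComplex.flip.obj K₂).commShiftIso (1 : ℤ)).hom.app K₁ =
      (mapBifunctorMappingConeIso F φ K₂).hom ≫ (triangle ((F.map₂CochainComplex.flip.obj K₂).map φ)).mor₃ :=
  map_triangle_mor₃ F φ K₂

variable [HasDerivedCategory.{w} C]
  (hΦ : (HomologicalComplex.quasiIso C (ComplexShape.up ℤ)).IsInvertedBy
    (F.map₂CochainComplex.flip.obj K₂ ⋙ DerivedCategory.Q))

/-- The factorisation isomorphism `Q ⋙ derivedLift Φ ≅ Φ ⋙ Q` is compatible with the shifts (Mathlib's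
`NatTrans.commShift_iso_hom_of_localization`, for the `CommShift` structure `Functor.commShiftOfLocalization` that
`DerivedDescent.derivedLift_commShift` uses). [folklore] -/
instance derivedLiftFac_hom_commShift :
    NatTrans.CommShift (derivedLiftFac (F.map₂CochainComplex.flip.obj K₂) hΦ).hom ℤ :=
  NatTrans.commShift_iso_hom_of_localization DerivedCategory.Q
    (HomologicalComplex.quasiIso C (ComplexShape.up ℤ)) ℤ (F.map₂CochainComplex.flip.obj K₂ ⋙ DerivedCategory.Q)
    (derivedLift (F.map₂CochainComplex.flip.obj K₂) hΦ)

/-- **The descended functor maps connecting morphisms to connecting morphisms** (transcription of Mathlib's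
`DerivedCategory.map_triangleOfSESδ` to `derivedLift Φ`, `Φ = mapBifunctor (–) K₂ F`): for `S` short exact with `Φ S`
short exact, `(derivedLift Φ).map δ_S = Fac_{X₃} ≫ δ_{Φ S} ≫ Fac⁻¹_{X₁}⟦1⟧ ≫ (commShiftIso 1)⁻¹`. [folklore] -/
theorem derivedLift_map_triangleOfSESδ {S : ShortComplex (CochainComplex C ℤ)} (hS : S.ShortExact)
    (hS' : (S.map (F.map₂CochainComplex.flip.obj K₂)).ShortExact) :
    (derivedLift (F.map₂CochainComplex.flip.obj K₂) hΦ).map (triangleOfSESδ hS) =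
      (derivedLiftFac (F.map₂CochainComplex.flip.obj K₂) hΦ).hom.app S.X₃ ≫ triangleOfSESδ hS' ≫
        ((derivedLiftFac (F.map₂CochainComplex.flip.obj K₂) hΦ).inv.app S.X₁)⟦(1 : ℤ)⟧' ≫
          ((derivedLift (F.map₂CochainComplex.flip.obj K₂) hΦ).commShiftIso (1 : ℤ)).inv.app
            (DerivedCategory.Q.obj S.X₁) := by
  have := CochainComplex.mappingCone.quasiIso_descShortComplex hS
  -- (1) the shift compatibility of the factorisation isomorphism, unfolded
  have key : (derivedLift (F.map₂CochainComplex.flip.obj K₂) hΦ).map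
      ((DerivedCategory.Q.commShiftIso (1 : ℤ)).hom.app S.X₁) =
      (derivedLiftFac (F.map₂CochainComplex.flip.obj K₂) hΦ).hom.app (S.X₁⟦(1 : ℤ)⟧) ≫
        DerivedCategory.Q.map (((F.map₂CochainComplex.flip.obj K₂).commShiftIso (1 : ℤ)).hom.app S.X₁) ≫
          (DerivedCategory.Q.commShiftIso (1 : ℤ)).hom.app ((F.map₂CochainComplex.flip.obj K₂).obj S.X₁) ≫
            ((derivedLiftFac (F.map₂CochainComplex.flip.obj K₂) hΦ).inv.app S.X₁)⟦(1 : ℤ)⟧' ≫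
              ((derivedLift (F.map₂CochainComplex.flip.obj K₂) hΦ).commShiftIso (1 : ℤ)).inv.app
                (DerivedCategory.Q.obj S.X₁) := by
    have h := NatTrans.shift_app_comm (derivedLiftFac (F.map₂CochainComplex.flip.obj K₂) hΦ).hom (1 : ℤ) S.X₁
    rw [Functor.commShiftIso_comp_hom_app, Functor.commShiftIso_comp_hom_app, Category.assoc] at h
    rw [← reassoc_of% h, ← Functor.map_comp_assoc, Iso.hom_inv_id_app, CategoryTheory.Functor.map_id]
    erw [Category.id_comp]
    rw [Iso.hom_inv_id_app]
    erw [Category.comp_id]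
  -- (2) transcription of Mathlib's `DerivedCategory.map_triangleOfSESδ`
  rw [← cancel_epi ((derivedLift (F.map₂CochainComplex.flip.obj K₂) hΦ).map
    (DerivedCategory.Q.map (CochainComplex.mappingCone.descShortComplex S))), ← Functor.map_comp,
    descShortComplex_triangleOfSESδ, Functor.map_comp, key]
  have nat : (derivedLift (F.map₂CochainComplex.flip.obj K₂) hΦ).map
      (DerivedCategory.Q.map (CochainComplex.mappingCone.descShortComplex S)) ≫
        (derivedLiftFac (F.map₂CochainComplex.flip.obj K₂) hΦ).hom.app S.X₃ =
      (derivedLiftFac (F.map₂CochainComplex.flip.obj K₂) hΦ).hom.app (mappingCone S.f) ≫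
        DerivedCategory.Q.map ((F.map₂CochainComplex.flip.obj K₂).map
          (CochainComplex.mappingCone.descShortComplex S)) :=
    (derivedLiftFac (F.map₂CochainComplex.flip.obj K₂) hΦ).hom.naturality _
  have nat₃ : (derivedLift (F.map₂CochainComplex.flip.obj K₂) hΦ).map
      (DerivedCategory.Q.map (triangle S.f).mor₃) ≫
        (derivedLiftFac (F.map₂CochainComplex.flip.obj K₂) hΦ).hom.app (S.X₁⟦(1 : ℤ)⟧) =
      (derivedLiftFac (F.map₂CochainComplex.flip.obj K₂) hΦ).hom.app (mappingCone S.f) ≫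
        DerivedCategory.Q.map ((F.map₂CochainComplex.flip.obj K₂).map (triangle S.f).mor₃) :=
    (derivedLiftFac (F.map₂CochainComplex.flip.obj K₂) hΦ).hom.naturality _
  rw [reassoc_of% nat, map_descShortComplex, Functor.map_comp_assoc, descShortComplex_triangleOfSESδ_assoc,
    ← DerivedCategory.Q.map_comp_assoc]
  erw [← map_triangle_mor₃']
  rw [DerivedCategory.Q.map_comp_assoc, reassoc_of% nat₃]
  rfl

/-- **`Φ_*(δ_S) = δ_{Φ S}`**: the action `DerivedDescent.shiftedHomMap` of `Φ = mapBifunctor (–) K₂ F` on shifted Homs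
sends the connecting morphism of a short exact `S` (with `Φ S` short exact) to the connecting morphism of `Φ S`.
[folklore] -/
theorem shiftedHomMap_triangleOfSESδ {S : ShortComplex (CochainComplex C ℤ)} (hS : S.ShortExact)
    (hS' : (S.map (F.map₂CochainComplex.flip.obj K₂)).ShortExact) :
    shiftedHomMap (F.map₂CochainComplex.flip.obj K₂) hΦ
        (triangleOfSESδ hS : ShiftedHom (DerivedCategory.Q.obj S.X₃) (DerivedCategory.Q.obj S.X₁) (1 : ℤ)) =
      triangleOfSESδ hS' := by
  rw [shiftedHomMap, ShiftedHom.map, derivedLift_map_triangleOfSESδ F K₂ hΦ hS hS']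
  simp only [Category.assoc, Iso.inv_hom_id_app_assoc, Iso.inv_hom_id_app]
  erw [Category.id_comp]
  rw [← Functor.map_comp, Iso.inv_hom_id_app]
  erw [CategoryTheory.Functor.map_id, Category.comp_id]

end BifunctorCone

end Summit.Ventures.HSemireg

end
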